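import Mathlib
import HarnessLib
import Summits.HubbardSuperconductivity.HubbardSuperconductivity.Theorems.KLProgrammeSectorisedLegKernelsDefs
import Summits.HubbardSuperconductivity.HubbardSuperconductivity.Theorems.KLProgrammeCooperVertexBlocksDefs

/-!
# Route `KLProgramme` — definitions: the LOCALISED Cooper array of the scale-`h` action on the torus carrier
# (the block object of (B1)/(E2) after p1's carrier decision Q-E2, HOME/p1/ENGINE-PRED.md §0)

Cell gate-hubbard-kl, seat p3.  p1's ENGINE-PRED §0 (05:39Z): the per-scale Cooper blocks of child 1 (B1) / engine (E2) are those
of the LOCALISED array `𝓛λ_h` — the quartic kernel EVALUATED at the sector-centre Fermi momenta (nearest lattice momenta) and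
the lowest frequencies (BGM 2006 (2.62)–(2.64), (3.65)) — not of the raw shell operator `klScaleBlockInf/Sup` (whose form bottom
differs from the localised one by a non-summable relative `O(1)` across the shell: `ℛλ_h` is irrelevant only against LOWER
scales).  This file types that object on the TORUS carrier `ℓ²((ℤ/Lℤ)²)` of D2 §2, so that the `D₄` action is the landed
`d4PermRep L` (unitary representation: `KLProgrammeCooperVertexBlocksModel.lean`) and no action on sector indices is needed:

* `nearestTorusSite L p` — the lattice momentum `k⃗ ∈ (ℤ/Lℤ)²` nearest to `p ∈ ℝ²` (`k_i = symmRound(L p_i / 2π) mod L`, with the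
  ODD rounding `symmRound` — round half away from zero — so that `p ↦ k⃗` is exactly `D₄`-equivariant);
  `klSectorSite L μ n ω̄` — the lattice momentum nearest to the sector-centre Fermi point `p̄(ω̄) = klSectorMomentum μ n ω̄`;
* `klSectorWeight … n ω̄` — the BCS-measure mass of the sector's fibre in the scale-`n` shell,
  `w_ω̄ = Σ_{k⃗ ∈ S_{Λ_n}} ν_{Λ_n}(k⃗) ζ̄_{n,ω̄}(θ(k⃗))` (D2's `bcsMeasure` × the isotropic angular weight): the discretisation of
  `ds/|∇ε|` over the sector — THE weight in which the single-scale bubble is `b_h · 1 + (small)` (C2-KILLTEST (A)), hence the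
  weight the block object must carry (an unweighted sector array has a direction-dependent bubble);
* `klLocArray … n ω̄ ω̄'` — the localised Cooper array `𝒞_h(k⃗_{ω̄}, k⃗_{ω̄'})` (`klCooperAmplitude` at the sector sites: lowest
  Matsubara pair, zero transfer) — the UNWEIGHTED entries (B3)(c) compares with `klIsoArray`;
* **`klLocCooperMatrix … n`** — the weighted, symmetrised localised Cooper matrix on the torus carrier,
  `A_h(k⃗, k⃗') = Σ_{ω̄,ω̄'} [k⃗ = k⃗_{ω̄}][k⃗' = k⃗_{ω̄'}] √w_ω̄ · 𝒞_h(k⃗_{ω̄}, k⃗_{ω̄'}) · √w_ω̄'` (supported on the sector sites; the exact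
  analogue of D2's `cooperMatrix = 𝟙_S √ν 𝒞 √ν` with sectors in place of shell points), `klLocCooperOp` its operator, and
  **`klLocBlockInf/Sup … n χ`** := `channelFormInf/Sup (d4PermRep L) (klLocCooperOp …) χ` — the block bottoms/tops (B1)/(E2)
  quantify over; C2 applies through `formInf_blockOp` / `le_formInf_of_forall_channelFormInf` exactly as for `klScaleBlockInf`
  (covariance of `A_h` under `d4Site` is the hypothesis `hcov` of `cooperOp_comm`-type lemmas, to be discharged from
  `cooperAmplitude_d4Site` + the `D₄`-equivariance of `ω̄ ↦ k⃗_{ω̄}` by whoever proves (E2)).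

Definitions with bodies only; no analytic claim.  References: HOME/p1/ENGINE-PRED.md §0 Q-E2, §2 (E2); HOME/prover-p1b/BETASPLIT-PRED.md
(B1), (B3)(c); BGM 2006 §2.6 (2.62)–(2.64), §3 (3.65); HOME/p3/C2-KILLTEST.md (A).
-/

noncomputable section

namespace Summit.HubbardSuperconductivity.HubbardSuperconductivity.Theorems.KLProgrammeLegKernels

set_option linter.dupNamespace false -- summit = problem name (single-conjunct summit), D-0017

open Real Literature.MathematicalPhysics.QuantumLattice Literature.Probability.LatticeModels
open Summit.HubbardSuperconductivity.HubbardSuperconductivity.Theorems.CooperVertexBlocks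

variable (L M : ℕ) [NeZero L]

/-! ### Sector sites -/

/-- **Symmetric rounding** (round half AWAY FROM ZERO): the nearest integer, ties `m + ½` decided towards `±∞` according to the
sign — an ODD function (`symmRound (-x) = -symmRound x`, unlike Mathlib's `round`, which sends `½ ↦ 1` but `-½ ↦ 0`), so that
coordinatewise rounding commutes with the signed coordinate permutations of `D₄`. -/
def symmRound (x : ℝ) : ℤ :=
  if 0 ≤ x then round x else -round (-x)

/-- **The lattice momentum nearest to a continuum momentum** `p ∈ ℝ²`: `k_i = symmRound(L p_i / (2π)) mod L`
(so that `latticeMomentum L k` is within `π/L` of `p` in each coordinate, modulo `2π`; the symmetric rounding makes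
`p ↦ k` EXACTLY `D₄`-equivariant, `nearestTorusSite L (γp) = d4Site γ (nearestTorusSite L p)`, ties included). -/
def nearestTorusSite (p : ℝ × ℝ) : TorusSite 2 L :=
  ![((symmRound ((L : ℝ) * p.1 / (2 * π)) : ℤ) : ZMod L), ((symmRound ((L : ℝ) * p.2 / (2 * π)) : ℤ) : ZMod L)]

/-- **The sector site**: the lattice momentum nearest to the sector-centre Fermi point `p̄(ω̄) = klSectorMomentum μ n ω̄` of the
isotropic sector `ω̄` at scale `h = -n` (BGM's localisation point for the leg in sector `ω̄`, (2.62)). -/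
def klSectorSite (μ : ℝ) (n : ℕ) (ω : Fin (sectorCount (2 * n))) : TorusSite 2 L :=
  nearestTorusSite L (klSectorMomentum μ n ω)

variable [NeZero M]

/-! ### Sector weights, the localised array, the localised Cooper matrix and its blocks -/

/-- **The BCS-measure mass of the sector's fibre in the scale-`n` shell**: `w_ω̄ = Σ_{k⃗ ∈ S_{Λ_n}} ν_{Λ_n}(k⃗) · ζ̄_{n,ω̄}(θ(k⃗))`
(`S_Λ = momentumShell`, `ν = bcsMeasure` of the scale-`n` action, `ζ̄` = `sectorWeightCirc (2n)`): the discrete `ds/|∇ε|`-mass of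
the sector — the weight in which the single-scale Cooper bubble is isotropic. -/
def klSectorWeight (β U μ : ℝ) (K : TrigPolyC4v) (e₀ : ℝ) (n : ℕ) (ω : Fin (sectorCount (2 * n))) : ℝ :=
  ∑ k ∈ momentumShell L (nambuXiCT L μ K) (klScale e₀ n),
    bcsMeasure L M β (klScale e₀ n) (klEffectiveAction L M β U μ K e₀ n) k * sectorWeightCirc (2 * n) ω (momentumAngle L k)

/-- **The localised Cooper array at scale `h = -n`**: `𝒞_h(k⃗_{ω̄}, k⃗_{ω̄'})` — the on-shell Cooper amplitude of the scale-`h`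
action (`klCooperAmplitude`: lowest Matsubara pair, zero pp-transfer) between the sector sites (unweighted entries). -/
def klLocArray (β U μ : ℝ) (K : TrigPolyC4v) (e₀ : ℝ) (n : ℕ) (ω ω' : Fin (sectorCount (2 * n))) : ℂ :=
  klCooperAmplitude L M β U μ K e₀ n (klSectorSite L μ n ω) (klSectorSite L μ n ω')

/-- **The localised, weighted Cooper matrix at scale `h = -n` on the torus carrier**:
`A_h(k⃗, k⃗') = Σ_{ω̄, ω̄'} [k⃗ = k⃗_{ω̄}] [k⃗' = k⃗_{ω̄'}] √w_ω̄ · 𝒞_h(k⃗_{ω̄}, k⃗_{ω̄'}) · √w_ω̄'` — supported on the sector sites, symmetrised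
with the sector weights (the sector analogue of D2's `cooperMatrix = 𝟙_S √ν 𝒞 √ν`). -/
def klLocCooperMatrix (β U μ : ℝ) (K : TrigPolyC4v) (e₀ : ℝ) (n : ℕ) : Matrix (TorusSite 2 L) (TorusSite 2 L) ℂ :=
  Matrix.of fun k k' =>
    ∑ ω : Fin (sectorCount (2 * n)), ∑ ω' : Fin (sectorCount (2 * n)),
      if k = klSectorSite L μ n ω ∧ k' = klSectorSite L μ n ω' then
        ((Real.sqrt (klSectorWeight L M β U μ K e₀ n ω) : ℝ) : ℂ) * klLocArray L M β U μ K e₀ n ω ω' *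
          ((Real.sqrt (klSectorWeight L M β U μ K e₀ n ω') : ℝ) : ℂ)
      else 0

/-- The localised Cooper matrix as an operator on `ℓ²((ℤ/Lℤ)²)` (`Matrix.toEuclideanCLM`, as D2's `cooperOp`). -/
def klLocCooperOp (β U μ : ℝ) (K : TrigPolyC4v) (e₀ : ℝ) (n : ℕ) :
    EuclideanSpace ℂ (TorusSite 2 L) →L[ℂ] EuclideanSpace ℂ (TorusSite 2 L) :=
  Matrix.toEuclideanCLM (n := TorusSite 2 L) (𝕜 := ℂ) (klLocCooperMatrix L M β U μ K e₀ n)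

/-- **The localised Cooper block bottom at scale `h = -n`, irrep `χ`** — the object (B1)/(E2) put in C2's envelopes
(`channelFormInf` for the unitary representation `d4PermRep L`; `= formInf (blockOp …)` by `formInf_blockOp` once the `D₄`-covariance
of `klLocCooperMatrix` is supplied). -/
def klLocBlockInf (β U μ : ℝ) (K : TrigPolyC4v) (e₀ : ℝ) (n : ℕ) (χ : D4Irrep) : ℝ :=
  channelFormInf (d4PermRep L) (klLocCooperOp L M β U μ K e₀ n) χ

/-- The localised Cooper block top at scale `h = -n`, irrep `χ`. -/
def klLocBlockSup (β U μ : ℝ) (K : TrigPolyC4v) (e₀ : ℝ) (n : ℕ) (χ : D4Irrep) : ℝ :=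
  channelFormSup (d4PermRep L) (klLocCooperOp L M β U μ K e₀ n) χ

omit [NeZero L] [NeZero M] in
/-- The sector site is the nearest lattice momentum to the sector centre (unfolding). -/
theorem klSectorSite_eq (μ : ℝ) (n : ℕ) (ω : Fin (sectorCount (2 * n))) :
    klSectorSite L μ n ω = nearestTorusSite L (klSectorMomentum μ n ω) := rfl

end Summit.HubbardSuperconductivity.HubbardSuperconductivity.Theorems.KLProgrammeLegKernels

end
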